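import Mathlib
import Summits.ValiantsHypothesis.ValiantsHypothesis.Theses.KPlusLogSqLaw
import Summits.ValiantsHypothesis.ValiantsHypothesis.Theorems.LacunarySymmetroidMatrixDescartesCensusTropicalKLawSlopes
import Summits.ValiantsHypothesis.ValiantsHypothesis.Theorems.LacunarySymmetroidMatrixDescartesStubDominantInjective
import Summits.ValiantsHypothesis.ValiantsHypothesis.Theorems.LacunarySymmetroidMatrixDescartesStubShadowEmbed
import Summits.ValiantsHypothesis.ValiantsHypothesis.Theorems.LacunarySymmetroidMatrixDescartesStubShadowTransport
import Summits.ValiantsHypothesis.ValiantsHypothesis.Theorems.LacunarySymmetroidMatrixDescartesStubShadowArith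
import Literature.Computability.AlgebraicComplexity.BirkhoffShadow

set_option linter.dupNamespace false
set_option autoImplicit false

/-!
# Route «KPlusLogSqLaw», crux `TropicalB` (stmt-ValiantsHypothesis-19771) — the tropical law is a consequence of a
# `2^{O(log² n)}` cap on Birkhoff shadows, and every counterexample to its regime stubs beats Carstensen's bound

Toward `stub_tropThin` / `stub_tropFat` of `Cruxes/TropicalB/Lines/birth.lean` and the plan-only SQUARE-TOWER rung
`∃ C, ∀ K, TropRow (K^2) K (2^(C·K))` (seat val-sym-trop-p5, refuter-adjacent lane: «the cheapest tropical
counterexample family against the stubs as typed, or the obstruction to one»).  NO closure claim: every theorem here is an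
IMPLICATION between statements that are open (TropicalB, the quasi-polynomial caps on Birkhoff shadows, Hrubeš–Yehudayoff's
Open Problem 1); nothing is asserted about `TropicalB` inside its window, about `MatrixDescartes`
(stmt-ValiantsHypothesis-18050) or about VP ≠ VNP.

Write `#vert(L, n)` for the number of extreme points of the convex hull of the plane projection `L` of the `n × n`
permutation matrices (`Literature.Computability.AlgebraicComplexity.permMatrixPoints n`, the vertex set of the Birkhoff
polytope `DS_n`; `σ(DS_n) = max_L #vert(L, n)` is its shadow complexity, Hrubeš–Yehudayoff 2021 Prop. 23:
`2^{Ω(log² n)} ≤ σ(DS_n) ≤ 2^{O(n)}`, tree `HrubesYehudayoff2021_prop23_lower_holds` with `c = 1/100`).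

* `shadow_of_chain` — a sign-alternating chain of `n + 1` dominant terms of a design of format `(m, K)` gives a plane
  shadow of `DS_{m(K+2)}` with at least `n + 1` vertices (composition of the LANDED stubs `stub_dominantInjective`,
  `stub_shadowEmbed`, `stub_shadowTransport` of the MatrixDescartes line «Lift»); hence `tropRootLawAt_of_shadowBound`:
  a bound `V` on all shadows of `DS_{m(K+2)}` gives the tropical row `TropRootLawAt m K (V − 1)`.
* `tropicalB_of_shadowLogSqCap` — **HY-small ⇒ TB**: if for some `c, n₀` every plane shadow of `DS_n`, `n ≥ n₀`, has at
  most `2^(c·⌊log₂ n⌋²)` vertices, then `TropicalB` holds (with `C = 2n₀ + c·(3A + 18)`, `A` an absolute constant);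
  hence (`thinStub_of_tropicalB`, `fatStub_of_tropicalB`, `squareTower_of_tropicalB`) the statements of both regime stubs
  and the square-tower rung.  `squareTower_of_shadowQuasiPolyCap` — the square tower already follows from ANY
  quasi-polynomial cap `2^((⌊log₂ n⌋ + c)^c)` (the hypothesis of the tree's `not_tropicalMonster_of_shadow_cap`).
* Contrapositives, in the infinitely-often shape of the tree's `shadowBirkhoffIO_of_tropicalMonster`:
  `shadowLogSq_io_of_not_tropicalB` / `_of_not_thinStub` / `_of_not_fatStub` — a counterexample to `TropicalB`, or to
  either regime stub AS TYPED, yields for every `c` and infinitely many `n` a shadow of `DS_n` with more than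
  `2^(c·⌊log₂ n⌋²)` vertices, i.e. `σ(DS_n) = 2^{ω(log² n)}` along a sequence — beyond the Carstensen–Mulmuley–Shah lower
  bound by an unbounded factor in the exponent (the lower side of HY21 Open Problem 1, where the tree's crux
  `DivisionGap.ShadowBirkhoff`, stmt-ValiantsHypothesis-5069, has two dead lines); and
  `shadowBirkhoffIO_of_not_squareTower` — a counterexample to the square-tower rung yields super-quasi-polynomial
  shadows infinitely often (`2^((⌊log₂ n⌋+c)^c) < #vert` for all `c`, i.o.), the i.o. form of `ShadowBirkhoff` itself.

So the refuter lane of this crux is calibrated by kernel theorems: no «cheap» tropical counterexample (staircase, graft,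
odometer, torus, register designs …) exists unless it is at the same time a new lower bound for the shadow complexity of
the Birkhoff polytope; and a Gusfield-type quasi-polynomial bound for parametric ASSIGNMENT would close `TropicalB`.
[folklore] embedding of parametric assignment designs into Birkhoff shadows (Mulmuley–Shah 2001 Cor. 1.1; Hrubeš–Yehudayoff
2021 Thm 4 / Prop. 23), here through the tree's multi-class embedding on `m (K+2)` nodes.
-/

namespace Summit.ValiantsHypothesis.ValiantsHypothesis.Theorems.KPlusLogSqLaw

open Summit.ValiantsHypothesis.ValiantsHypothesis.Theorems.MatrixDescartes.Negative
open Summit.ValiantsHypothesis.ValiantsHypothesis.Theorems.LacunarySymmetroidMatrixDescartes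
open Summit.ValiantsHypothesis.ValiantsHypothesis.Theorems.LacunarySymmetroidMatrixDescartes.TropicalCensus
open Summit.ValiantsHypothesis.ValiantsHypothesis.Theses.KPlusLogSqLaw (TropicalB)
open Literature.Computability.AlgebraicComplexity (permMatrixPoints)

/-! ## 1. Chains are shadow vertices -/

/-- **A dominant chain is a set of shadow vertices.**  A chain of `n + 1` terms of a design of format `(m, K)`, dominant at
strictly increasing integer slopes with alternating signs, yields a linear plane projection of the `(m(K+2)) × (m(K+2))`
permutation matrices whose convex hull has at least `n + 1` extreme points. [folklore] -/
theorem shadow_of_chain (m K : ℕ) (d : Fin K → ℕ) (v ε : Fin m → Fin m → Fin K → ℤ) (n : ℕ)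
    (θ : Fin (n + 1) → ℤ) (p : Fin (n + 1) → Equiv.Perm (Fin m) × (Fin m → Fin K))
    (hθ : StrictMono θ) (hdom : ∀ k, IsDominant d v ε (θ k) (p k))
    (halt : ∀ k : Fin n, termSign ε (p k.castSucc) * termSign ε (p k.succ) < 0) :
    ∃ L : (Fin (m * (K + 2)) × Fin (m * (K + 2)) → ℝ) →ₗ[ℝ] (Fin 2 → ℝ),
      n + 1 ≤ Set.ncard (Set.extremePoints ℝ (convexHull ℝ (L '' permMatrixPoints (m * (K + 2))))) := by
  have hinj : Function.Injective p := stub_dominantInjective m K d v ε n θ p hθ hdom halt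
  obtain ⟨L, hL⟩ := stub_shadowEmbed m K d v ε n θ p hdom hinj
  obtain ⟨L', hL'⟩ := stub_shadowTransport (Fin m × Fin (K + 2)) (m * (K + 2)) finProdFinEquiv L
  exact ⟨L', by rw [hL']; exact hL⟩

/-- **A shadow bound is a tropical row.**  If every plane shadow of the permutation matrices on `m (K+2)` nodes has at
most `V` vertices, then every sign-alternating dominant chain of format `(m, K)` has at most `V − 1` sign changes:
`TropRootLawAt m K (V − 1)`. [folklore] -/
theorem tropRootLawAt_of_shadowBound (m K V : ℕ)
    (hV : ∀ L : (Fin (m * (K + 2)) × Fin (m * (K + 2)) → ℝ) →ₗ[ℝ] (Fin 2 → ℝ),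
      Set.ncard (Set.extremePoints ℝ (convexHull ℝ (L '' permMatrixPoints (m * (K + 2))))) ≤ V) :
    TropRootLawAt m K (V - 1) := by
  intro d v ε n θ p _hε hθ hdom halt
  obtain ⟨L, hL⟩ := shadow_of_chain m K d v ε n θ p hθ hdom halt
  have := hL.trans (hV L)
  omega

/-! ## 2. Arithmetic of the node count `m (K + 2)` -/

/-- `⌊log₂ (a b)⌋ < ⌊log₂ a⌋ + ⌊log₂ b⌋ + 2` (strict form of the folklore `log₂(ab) ≤ log₂ a + log₂ b + 1`, which the
tree holds only inside unrelated heavy Literature closures — `Khot.log2_mul_le`, `MurrayWilliams….log_mul_le`; not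
imported here). [folklore] -/
theorem log_two_mul_lt (a b : ℕ) : Nat.log 2 (a * b) < Nat.log 2 a + Nat.log 2 b + 2 := by
  rcases Nat.eq_zero_or_pos a with rfl | ha
  · simp
  rcases Nat.eq_zero_or_pos b with rfl | hb
  · simp
  have h1 : a < 2 ^ (Nat.log 2 a + 1) := Nat.lt_pow_succ_log_self one_lt_two a
  have h2 : b < 2 ^ (Nat.log 2 b + 1) := Nat.lt_pow_succ_log_self one_lt_two b
  have h3 : a * b < 2 ^ (Nat.log 2 a + Nat.log 2 b + 2) := by
    have e : 2 ^ (Nat.log 2 a + Nat.log 2 b + 2) = 2 ^ (Nat.log 2 a + 1) * 2 ^ (Nat.log 2 b + 1) := by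
      rw [← pow_add]; ring_nf
    rw [e]
    exact Nat.mul_lt_mul_of_lt_of_le h1 h2.le (by positivity)
  exact Nat.log_lt_of_lt_pow (Nat.pos_iff_ne_zero.1 (Nat.mul_pos ha hb)) h3

/-- `(a + b + 1)² ≤ 3 (a² + b² + 1)`. [folklore] -/
theorem sq_add_add_one_le (a b : ℕ) : (a + b + 1) ^ 2 ≤ 3 * (a ^ 2 + b ^ 2 + 1) := by
  zify
  nlinarith [sq_nonneg ((a : ℤ) - b), sq_nonneg ((a : ℤ) - 1), sq_nonneg ((b : ℤ) - 1)]

/-- `⌊log₂ x⌋² ≤ x + A` for an absolute constant `A` (squares versus powers of two). [folklore] -/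
theorem exists_logsq_le_add : ∃ A : ℕ, ∀ x : ℕ, Nat.log 2 x ^ 2 ≤ x + A := by
  obtain ⟨L₁, hL₁⟩ := StubShadowArith.poly_le_two_pow 0 2 1
  refine ⟨L₁ ^ 2, fun x => ?_⟩
  rcases Nat.eq_zero_or_pos x with rfl | hx
  · simp
  by_cases hj : L₁ ≤ Nat.log 2 x
  · have h1 := hL₁ (Nat.log 2 x) hj
    have h2 : 2 ^ Nat.log 2 x ≤ x := Nat.pow_log_le_self 2 (Nat.pos_iff_ne_zero.1 hx)
    simp only [add_zero, one_mul] at h1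
    omega
  · push Not at hj
    have : Nat.log 2 x ^ 2 ≤ L₁ ^ 2 := Nat.pow_le_pow_left hj.le 2
    omega

/-- The exponent comparison behind `tropicalB_of_shadowLogSqCap`: for `K ≥ 1`,
`⌊log₂ (m (K+2))⌋² ≤ (3A + 18)(K + ⌊log₂ m⌋²)` where `A` is the constant of `exists_logsq_le_add`. -/
theorem logsq_nodes_le (A : ℕ) (hA : ∀ x : ℕ, Nat.log 2 x ^ 2 ≤ x + A) (m K : ℕ) (hK : 1 ≤ K) :
    Nat.log 2 (m * (K + 2)) ^ 2 ≤ (3 * A + 18) * (K + Nat.log 2 m ^ 2) := by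
  have h1 : Nat.log 2 (m * (K + 2)) ≤ Nat.log 2 m + Nat.log 2 (K + 2) + 1 := by
    have := log_two_mul_lt m (K + 2); omega
  have h2 : Nat.log 2 (m * (K + 2)) ^ 2 ≤ (Nat.log 2 m + Nat.log 2 (K + 2) + 1) ^ 2 :=
    Nat.pow_le_pow_left h1 2
  have h3 := sq_add_add_one_le (Nat.log 2 m) (Nat.log 2 (K + 2))
  have h4 := hA (K + 2)
  nlinarith [h2, h3, h4, hK, Nat.zero_le (Nat.log 2 m ^ 2), Nat.zero_le A]

/-! ## 3. A `2^{O(log² n)}` cap on Birkhoff shadows gives `TropicalB` -/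

/-- **HY-small ⇒ TB.**  If for some `c, n₀` every plane shadow of the `n × n` permutation matrices, `n ≥ n₀`, has at most
`2^(c·⌊log₂ n⌋²)` vertices (a Gusfield-type quasi-polynomial bound for parametric ASSIGNMENT — not known; Hrubeš–Yehudayoff
2021 Open Problem 1 asks whether instead `σ(DS_n)` is exponential), then the tropical `K + log² m` law `TropicalB` holds. -/
theorem tropicalB_of_shadowLogSqCap
    (hcap : ∃ c n₀ : ℕ, ∀ n : ℕ, n₀ ≤ n → ∀ L : (Fin n × Fin n → ℝ) →ₗ[ℝ] (Fin 2 → ℝ),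
      Set.ncard (Set.extremePoints ℝ (convexHull ℝ (L '' permMatrixPoints n))) ≤ 2 ^ (c * Nat.log 2 n ^ 2)) :
    TropicalB := by
  obtain ⟨c, n₀, hcap⟩ := hcap
  obtain ⟨A, hA⟩ := exists_logsq_le_add
  refine ⟨2 * n₀ + c * (3 * A + 18), fun m K => ?_⟩
  show TropRootLawAt m K (2 ^ ((2 * n₀ + c * (3 * A + 18)) * (K + Nat.log 2 m ^ 2)))
  rcases Nat.eq_zero_or_pos K with rfl | hK
  · exact tropRootLawAt_zero m _
  rcases Nat.eq_zero_or_pos m with rfl | hm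
  · -- no rows: a single Leibniz term, no sign change
    refine tropRootLawAt_mono (Nat.zero_le _) ?_
    have h := tropRootLawAt_choose 0 K
    simpa using h
  by_cases hn : n₀ ≤ m * (K + 2)
  · -- the cap applies at `n = m (K + 2)` nodes
    have hrow := tropRootLawAt_of_shadowBound m K (2 ^ (c * Nat.log 2 (m * (K + 2)) ^ 2)) (hcap _ hn)
    refine tropRootLawAt_mono ((Nat.sub_le _ _).trans (Nat.pow_le_pow_right (by norm_num) ?_)) hrow
    have h := logsq_nodes_le A hA m K hK
    calc c * Nat.log 2 (m * (K + 2)) ^ 2 ≤ c * ((3 * A + 18) * (K + Nat.log 2 m ^ 2)) := Nat.mul_le_mul_left c h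
      _ = (c * (3 * A + 18)) * (K + Nat.log 2 m ^ 2) := by ring
      _ ≤ (2 * n₀ + c * (3 * A + 18)) * (K + Nat.log 2 m ^ 2) := Nat.mul_le_mul_right _ (Nat.le_add_left _ _)
  · -- finitely many small formats: slope counting
    push Not at hn
    have e1 : K + 2 ≤ m * (K + 2) := Nat.le_mul_of_pos_left _ hm
    have e2 : m ≤ m * (K + 2) := Nat.le_mul_of_pos_right _ (by omega)
    have hmK : K + m - 1 ≤ 2 * n₀ := by omega
    have e3 : 1 ≤ K + Nat.log 2 m ^ 2 := le_trans hK (Nat.le_add_right K _)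
    refine tropRootLawAt_mono ?_ (tropRootLawAt_choose m K)
    calc (K + m - 1).choose m - 1 ≤ (K + m - 1).choose m := Nat.sub_le _ _
      _ ≤ 2 ^ (K + m - 1) := Nat.choose_le_two_pow _ _
      _ ≤ 2 ^ (2 * n₀) := Nat.pow_le_pow_right (by norm_num) hmK
      _ ≤ 2 ^ ((2 * n₀ + c * (3 * A + 18)) * (K + Nat.log 2 m ^ 2)) := by
          refine Nat.pow_le_pow_right (by norm_num) ?_
          calc 2 * n₀ ≤ 2 * n₀ + c * (3 * A + 18) := Nat.le_add_right _ _
            _ = (2 * n₀ + c * (3 * A + 18)) * 1 := (mul_one _).symm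
            _ ≤ (2 * n₀ + c * (3 * A + 18)) * (K + Nat.log 2 m ^ 2) := Nat.mul_le_mul_left _ e3

/-- TB gives the THIN regime stub of the birth skeleton (`stub_tropThin`, stated over the tree name `TropRootLawAt`,
δ-equal to the skeleton's `TropRow`), with `C ↦ 2C`. -/
theorem thinStub_of_tropicalB (h : TropicalB) :
    ∃ C : ℕ, ∀ m K : ℕ, K ≤ Nat.log 2 m ^ 2 → TropRootLawAt m K (2 ^ (C * Nat.log 2 m ^ 2)) := by
  obtain ⟨C, hC⟩ := h
  refine ⟨2 * C, fun m K hK => tropRootLawAt_mono (Nat.pow_le_pow_right (by norm_num) ?_) (hC m K)⟩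
  nlinarith

/-- TB gives the FAT regime stub of the birth skeleton (`stub_tropFat`), with `C ↦ 2C`. -/
theorem fatStub_of_tropicalB (h : TropicalB) :
    ∃ C : ℕ, ∀ m K : ℕ, Nat.log 2 m ^ 2 ≤ K → TropRootLawAt m K (2 ^ (C * K)) := by
  obtain ⟨C, hC⟩ := h
  refine ⟨2 * C, fun m K hK => tropRootLawAt_mono (Nat.pow_le_pow_right (by norm_num) ?_) (hC m K)⟩
  nlinarith

/-- `⌊log₂ (K²)⌋² ≤ K + A'` for an absolute constant `A'`. [folklore] -/
theorem exists_logsq_sq_le_add : ∃ A' : ℕ, ∀ K : ℕ, Nat.log 2 (K ^ 2) ^ 2 ≤ K + A' := by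
  obtain ⟨L₁, hL₁⟩ := StubShadowArith.poly_le_two_pow 1 2 4
  refine ⟨(2 * L₁ + 1) ^ 2, fun K => ?_⟩
  rcases Nat.eq_zero_or_pos K with rfl | hK
  · simp
  have h1 : Nat.log 2 (K ^ 2) ≤ 2 * Nat.log 2 K + 1 := by
    have := log_two_mul_lt K K
    rw [sq]; omega
  have h2 : Nat.log 2 (K ^ 2) ^ 2 ≤ (2 * Nat.log 2 K + 1) ^ 2 := Nat.pow_le_pow_left h1 2
  by_cases hj : L₁ ≤ Nat.log 2 K
  · have h3 := hL₁ (Nat.log 2 K) hj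
    have h4 : 2 ^ Nat.log 2 K ≤ K := Nat.pow_log_le_self 2 (Nat.pos_iff_ne_zero.1 hK)
    have h5 : (2 * Nat.log 2 K + 1) ^ 2 ≤ 4 * (Nat.log 2 K + 1) ^ 2 := by nlinarith
    omega
  · push Not at hj
    have h6 : (2 * Nat.log 2 K + 1) ^ 2 ≤ (2 * L₁ + 1) ^ 2 := Nat.pow_le_pow_left (by omega) 2
    omega

/-- TB gives the SQUARE-TOWER rung (the plan-only in-window rung of the route's tribunal_fit): `T(K², K) ≤ 2^{C K}`. -/
theorem squareTower_of_tropicalB (h : TropicalB) : ∃ C : ℕ, ∀ K : ℕ, TropRootLawAt (K ^ 2) K (2 ^ (C * K)) := by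
  obtain ⟨C, hC⟩ := h
  obtain ⟨A', hA'⟩ := exists_logsq_sq_le_add
  refine ⟨C * (A' + 2), fun K => ?_⟩
  rcases Nat.eq_zero_or_pos K with rfl | hK
  · exact tropRootLawAt_zero _ _
  refine tropRootLawAt_mono (Nat.pow_le_pow_right (by norm_num) ?_) (hC (K ^ 2) K)
  have h1 := hA' K
  calc C * (K + Nat.log 2 (K ^ 2) ^ 2) ≤ C * (K + (K + A')) := Nat.mul_le_mul_left C (by omega)
    _ ≤ C * ((A' + 2) * K) := Nat.mul_le_mul_left C (by nlinarith)
    _ = C * (A' + 2) * K := by ring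

/-- **Any quasi-polynomial shadow cap gives the square tower.**  If for some `c, n₀` every plane shadow of the `n × n`
permutation matrices, `n ≥ n₀`, has at most `2^((⌊log₂ n⌋ + c)^c)` vertices (the hypothesis of the tree's
`not_tropicalMonster_of_shadow_cap`), then `∃ C, ∀ K, TropRootLawAt (K^2) K (2^(C K))`. -/
theorem squareTower_of_shadowQuasiPolyCap
    (hcap : ∃ c n₀ : ℕ, ∀ n : ℕ, n₀ ≤ n → ∀ L : (Fin n × Fin n → ℝ) →ₗ[ℝ] (Fin 2 → ℝ),
      Set.ncard (Set.extremePoints ℝ (convexHull ℝ (L '' permMatrixPoints n))) ≤ 2 ^ ((Nat.log 2 n + c) ^ c)) :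
    ∃ C : ℕ, ∀ K : ℕ, TropRootLawAt (K ^ 2) K (2 ^ (C * K)) := by
  obtain ⟨c, n₀, hcap⟩ := hcap
  obtain ⟨L₁, hL₁⟩ := StubShadowArith.poly_le_two_pow (c + 4) c (3 ^ c)
  -- `E(K) := (⌊log₂ (K²(K+2))⌋ + c)^c ≤ K + A` for all `K ≥ 1`
  obtain ⟨A, hAdef⟩ : ∃ A : ℕ, A = (3 * L₁ + (c + 4)) ^ c := ⟨_, rfl⟩
  have hE : ∀ K : ℕ, 1 ≤ K → (Nat.log 2 (K ^ 2 * (K + 2)) + c) ^ c ≤ K + A := by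
    intro K hK
    have hK0 : K ≠ 0 := by omega
    have l1 : Nat.log 2 (K ^ 2) ≤ 2 * Nat.log 2 K + 1 := by
      have := log_two_mul_lt K K
      rw [sq]; omega
    have l2 : Nat.log 2 (K + 2) ≤ Nat.log 2 K + 3 := by
      have h4 : K + 2 ≤ K * 4 := by omega
      have h5 : Nat.log 2 (4 : ℕ) = 2 := by
        rw [show (4 : ℕ) = 2 ^ 2 by norm_num, Nat.log_pow one_lt_two]
      have h6 := log_two_mul_lt K 4
      have h7 : Nat.log 2 (K + 2) ≤ Nat.log 2 (K * 4) := Nat.log_mono_right h4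
      omega
    have l3 : Nat.log 2 (K ^ 2 * (K + 2)) ≤ 3 * Nat.log 2 K + 5 := by
      have := log_two_mul_lt (K ^ 2) (K + 2)
      omega
    have l4 : (Nat.log 2 (K ^ 2 * (K + 2)) + c) ^ c ≤ (3 * Nat.log 2 K + 5 + c) ^ c :=
      Nat.pow_le_pow_left (by omega) c
    by_cases hj : L₁ ≤ Nat.log 2 K
    · have h5 := hL₁ (Nat.log 2 K) hj
      have h6 : (3 * Nat.log 2 K + 5 + c) ^ c ≤ 3 ^ c * (Nat.log 2 K + (c + 4)) ^ c := by
        rw [← mul_pow]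
        exact Nat.pow_le_pow_left (by omega) c
      have h7 : 2 ^ Nat.log 2 K ≤ K := Nat.pow_log_le_self 2 hK0
      omega
    · push Not at hj
      have h8 : (3 * Nat.log 2 K + 5 + c) ^ c ≤ A := by
        rw [hAdef]
        exact Nat.pow_le_pow_left (by omega) c
      omega
  refine ⟨n₀ ^ 2 + n₀ + A + 1, fun K => ?_⟩
  rcases Nat.eq_zero_or_pos K with rfl | hK
  · exact tropRootLawAt_zero _ _
  by_cases hn : n₀ ≤ K ^ 2 * (K + 2)
  · have hrow := tropRootLawAt_of_shadowBound (K ^ 2) K (2 ^ ((Nat.log 2 (K ^ 2 * (K + 2)) + c) ^ c)) (hcap _ hn)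
    refine tropRootLawAt_mono ((Nat.sub_le _ _).trans (Nat.pow_le_pow_right (by norm_num) ?_)) hrow
    have h := hE K hK
    nlinarith
  · push Not at hn
    have hKn : K < n₀ := by nlinarith
    refine tropRootLawAt_mono ?_ (tropRootLawAt_choose (K ^ 2) K)
    have hb : K + K ^ 2 - 1 ≤ n₀ ^ 2 + n₀ := by
      have : K ^ 2 ≤ n₀ ^ 2 := Nat.pow_le_pow_left hKn.le 2
      omega
    calc (K + K ^ 2 - 1).choose (K ^ 2) - 1 ≤ (K + K ^ 2 - 1).choose (K ^ 2) := Nat.sub_le _ _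
      _ ≤ 2 ^ (K + K ^ 2 - 1) := Nat.choose_le_two_pow _ _
      _ ≤ 2 ^ (n₀ ^ 2 + n₀) := Nat.pow_le_pow_right (by norm_num) hb
      _ ≤ 2 ^ ((n₀ ^ 2 + n₀ + A + 1) * K) := Nat.pow_le_pow_right (by norm_num) (by nlinarith)

/-! ## 4. Contrapositives: every counterexample beats Carstensen's bound -/

/-- **¬TB ⇒ super-Carstensen Birkhoff shadows, infinitely often.**  A counterexample to `TropicalB` yields, for every `c`
and infinitely many `n`, a plane shadow of the `n × n` permutation matrices with more than `2^(c·⌊log₂ n⌋²)` vertices. -/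
theorem shadowLogSq_io_of_not_tropicalB (h : ¬ TropicalB) :
    ∀ c n₀ : ℕ, ∃ n : ℕ, n₀ ≤ n ∧ ∃ L : (Fin n × Fin n → ℝ) →ₗ[ℝ] (Fin 2 → ℝ),
      2 ^ (c * Nat.log 2 n ^ 2) < Set.ncard (Set.extremePoints ℝ (convexHull ℝ (L '' permMatrixPoints n))) := by
  intro c n₀
  by_contra hcon
  push Not at hcon
  exact h (tropicalB_of_shadowLogSqCap ⟨c, n₀, fun n hn L => hcon n hn L⟩)

/-- A counterexample to the THIN stub as typed (`stub_tropThin`) beats every `2^(c·⌊log₂ n⌋²)` on Birkhoff shadows,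
infinitely often. -/
theorem shadowLogSq_io_of_not_thinStub
    (h : ¬ ∃ C : ℕ, ∀ m K : ℕ, K ≤ Nat.log 2 m ^ 2 → TropRootLawAt m K (2 ^ (C * Nat.log 2 m ^ 2))) :
    ∀ c n₀ : ℕ, ∃ n : ℕ, n₀ ≤ n ∧ ∃ L : (Fin n × Fin n → ℝ) →ₗ[ℝ] (Fin 2 → ℝ),
      2 ^ (c * Nat.log 2 n ^ 2) < Set.ncard (Set.extremePoints ℝ (convexHull ℝ (L '' permMatrixPoints n))) :=
  shadowLogSq_io_of_not_tropicalB fun hT => h (thinStub_of_tropicalB hT)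

/-- A counterexample to the FAT stub as typed (`stub_tropFat`) beats every `2^(c·⌊log₂ n⌋²)` on Birkhoff shadows,
infinitely often. -/
theorem shadowLogSq_io_of_not_fatStub
    (h : ¬ ∃ C : ℕ, ∀ m K : ℕ, Nat.log 2 m ^ 2 ≤ K → TropRootLawAt m K (2 ^ (C * K))) :
    ∀ c n₀ : ℕ, ∃ n : ℕ, n₀ ≤ n ∧ ∃ L : (Fin n × Fin n → ℝ) →ₗ[ℝ] (Fin 2 → ℝ),
      2 ^ (c * Nat.log 2 n ^ 2) < Set.ncard (Set.extremePoints ℝ (convexHull ℝ (L '' permMatrixPoints n))) :=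
  shadowLogSq_io_of_not_tropicalB fun hT => h (fatStub_of_tropicalB hT)

/-- **¬(square tower) ⇒ super-quasi-polynomial Birkhoff shadows, infinitely often** — the conclusion of the tree's
`shadowBirkhoffIO_of_tropicalMonster`, i.e. the infinitely-often form of `DivisionGap.ShadowBirkhoff`
(stmt-ValiantsHypothesis-5069; Hrubeš–Yehudayoff 2021, Open Problem 1, weak form). -/
theorem shadowBirkhoffIO_of_not_squareTower (h : ¬ ∃ C : ℕ, ∀ K : ℕ, TropRootLawAt (K ^ 2) K (2 ^ (C * K))) :
    ∀ c n₀ : ℕ, ∃ n : ℕ, n₀ ≤ n ∧ ∃ L : (Fin n × Fin n → ℝ) →ₗ[ℝ] (Fin 2 → ℝ),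
      2 ^ ((Nat.log 2 n + c) ^ c) < Set.ncard (Set.extremePoints ℝ (convexHull ℝ (L '' permMatrixPoints n))) := by
  intro c n₀
  by_contra hcon
  push Not at hcon
  exact h (squareTower_of_shadowQuasiPolyCap ⟨c, n₀, fun n hn L => hcon n hn L⟩)

end Summit.ValiantsHypothesis.ValiantsHypothesis.Theorems.KPlusLogSqLaw
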